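import Mathlib.NumberTheory.NumberField.ClassNumber
import Mathlib.NumberTheory.RamificationInertia.Galois
import Mathlib.RingTheory.DedekindDomain.Factorization
import Mathlib.FieldTheory.Galois.IsGaloisGroup
import HarnessLib

/-!
# In a quadratic field the conjugate of an ideal class is its inverse

Topic `NumberTheory/QuadraticFields`.  Theorem-only file (no definition, no named fact).

Let `K` be a quadratic number field with non-trivial automorphism `τ`.  For every nonzero prime
`𝔭` of `𝓞_K` the classes of `𝔭` and of its conjugate `τ𝔭` are inverse to each other in
`Cl(𝓞_K)`: `[𝔭] · [τ𝔭] = 1` (`mk0_mul_mk0_smul_eq_one`).  Indeed with `(p) = 𝔭 ∩ ℤ` one has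
`p𝓞_K = ∏_{𝔮 ∣ p} 𝔮^{e}` (Mathlib `Ideal.map_algebraMap_eq_finsetProd_pow`), the primes above `p`
are the conjugates of `𝔭` (transitivity of `Gal(K/ℚ) = {1, τ}`), and `efg = 2`: if `τ𝔭 ≠ 𝔭` then
`p𝓞_K = 𝔭 · τ𝔭` is principal; if `τ𝔭 = 𝔭` then `p𝓞_K = 𝔭^e` with `e ∣ 2`, so `[𝔭]² = 1`
(Marcus, *Number Fields*, Ch. 3, Thm. 25 and the discussion of quadratic fields after it;
Cox, *Primes of the form x² + ny²*, §7.B: "the class of the conjugate ideal `𝔞̄` is the inverse of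
the class of `𝔞`", cf. `Literature.NumberTheory.QuadraticFields.Quadratic.mk0_formIdeal_neg_eq_inv`
for the form-theoretic version in the imaginary case).  Consequently `τ` acts on `Cl(𝓞_K)` by
inversion on the prime classes.

* `eq_one_or_eq_of_card_eq_two` — `Gal(K/ℚ) = {1, τ}`;
* `smul_asIdeal_mem_nonZeroDivisors`, `mk0_mul_mk0_smul_eq_one` — the statement, with the
  conjugate written as the pointwise image `τ • 𝔭` under the Galois action on `𝓞_K`
  (Mathlib `MulSemiringAction (K ≃ₐ[ℚ] K) (𝓞 K)`);
* `smul_eq_map_mapRingEquiv` — `τ • 𝔞 = 𝓞(τ)(𝔞)` (`RingOfIntegers.mapRingEquiv`), the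
  spelling used by `Literature/NumberTheory/NumberFields/BaseAutomorphismTransport.lean`.

## References

* D. A. Marcus, *Number Fields*, 2nd ed. (2018), Ch. 3, Thm. 25 ff. [Marcus2018]
* D. A. Cox, *Primes of the form x² + ny²*, 2nd ed. (2013), §7.B. [Cox2013]
-/

noncomputable section

open NumberField IsDedekindDomain
open scoped nonZeroDivisors Pointwise

namespace Literature.NumberTheory.QuadraticFields

variable {K : Type*} [Field K] [NumberField K]

/-- In a group of order `2` with a non-trivial element `τ`, every element is `1` or `τ`.
[folklore] -/
theorem eq_one_or_eq_of_card_eq_two {G : Type*} [Group G] (hG : Nat.card G = 2) {τ : G}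
    (hτ : τ ≠ 1) (σ : G) : σ = 1 ∨ σ = τ := by
  haveI : Finite G := Nat.finite_of_card_ne_zero (by rw [hG]; norm_num)
  have hsub : ({1, τ} : Set G) = Set.univ := by
    apply Set.eq_of_subset_of_ncard_le (Set.subset_univ _)
    rw [Set.ncard_univ, hG, Set.ncard_pair hτ.symm]
  have : σ ∈ ({1, τ} : Set G) := by rw [hsub]; exact Set.mem_univ σ
  simpa using this

/-- The Galois action on `𝓞_K` maps an ideal to its image under `𝓞(τ)`:
`τ • 𝔞 = (RingOfIntegers.mapRingEquiv τ)(𝔞)`. [folklore] -/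
theorem smul_eq_map_mapRingEquiv (τ : K ≃ₐ[ℚ] K) (I : Ideal (𝓞 K)) :
    τ • I = I.map (RingOfIntegers.mapRingEquiv τ.toRingEquiv) := by
  rw [Ideal.pointwise_smul_def]
  congr 1

/-- The conjugate of a nonzero prime is a nonzero ideal. [folklore] -/
theorem smul_asIdeal_mem_nonZeroDivisors (τ : K ≃ₐ[ℚ] K) (v : HeightOneSpectrum (𝓞 K)) :
    τ • v.asIdeal ∈ (Ideal (𝓞 K))⁰ := by
  rw [mem_nonZeroDivisors_iff_ne_zero, smul_eq_map_mapRingEquiv]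
  exact (Ideal.map_eq_bot_iff_of_injective (RingOfIntegers.mapRingEquiv τ.toRingEquiv).injective).not.mpr
    v.ne_bot

/-- **In a quadratic field the conjugate of a prime ideal class is its inverse**:
`[𝔭] · [τ𝔭] = 1` in `Cl(𝓞_K)` for the non-trivial automorphism `τ` of a quadratic field `K` and
every nonzero prime `𝔭` (`p𝓞_K = 𝔭 · τ𝔭` if `𝔭 ≠ τ𝔭`, and `p𝓞_K = 𝔭^e`, `e ∣ 2`, otherwise;
Marcus Ch. 3, Thm. 25 ff.; Cox §7.B). [cite: Marcus2018, Ch. 3, Thm. 25] [cite: Cox2013, §7.B] -/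
theorem mk0_mul_mk0_smul_eq_one (h2 : Module.finrank ℚ K = 2) (τ : K ≃ₐ[ℚ] K) (hτ : τ ≠ 1)
    (v : HeightOneSpectrum (𝓞 K)) :
    ClassGroup.mk0 ⟨v.asIdeal, mem_nonZeroDivisors_iff_ne_zero.mpr v.ne_bot⟩ *
      ClassGroup.mk0 ⟨τ • v.asIdeal, smul_asIdeal_mem_nonZeroDivisors τ v⟩ = 1 := by
  classical
  haveI : Algebra.IsQuadraticExtension ℚ K := ⟨h2⟩
  haveI : IsGaloisGroup (K ≃ₐ[ℚ] K) ℤ (𝓞 K) :=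
    IsGaloisGroup.of_isFractionRing (K ≃ₐ[ℚ] K) ℤ (𝓞 K) ℚ K
  have hG : Nat.card (K ≃ₐ[ℚ] K) = 2 := by rw [IsGalois.card_aut_eq_finrank, h2]
  -- the prime `p` of `ℤ` below `𝔭 = v.asIdeal`
  set P : Ideal (𝓞 K) := v.asIdeal with hPdef
  haveI := v.isMaximal
  set p : Ideal ℤ := P.under ℤ with hpdef
  haveI : p.IsMaximal := Ideal.IsMaximal.under ℤ P
  have hp0 : p ≠ ⊥ := mt Ideal.eq_bot_of_comap_eq_bot v.ne_bot
  have hPover : P ∈ p.primesOver (𝓞 K) := ⟨v.isPrime, ⟨rfl⟩⟩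
  -- `p 𝓞_K` is principal, and `= ∏_{𝔮 ∣ p} 𝔮 ^ e`
  have hfac := Ideal.map_algebraMap_eq_finsetProd_pow (R := 𝓞 K) hp0
  have hmap0 : p.map (algebraMap ℤ (𝓞 K)) ≠ ⊥ :=
    (Ideal.map_eq_bot_iff_of_injective (algebraMap ℤ (𝓞 K)).injective_int).not.mpr hp0
  have hprinc : ClassGroup.mk0 ⟨p.map (algebraMap ℤ (𝓞 K)),
      mem_nonZeroDivisors_iff_ne_zero.mpr hmap0⟩ = 1 := by
    rw [ClassGroup.mk0_eq_one_iff]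
    obtain ⟨p₀, hp₀⟩ := (IsPrincipalIdealRing.principal p).principal
    rw [Ideal.submodule_span_eq] at hp₀
    rw [hp₀, Ideal.map_span, Set.image_singleton]
    exact ⟨⟨algebraMap ℤ (𝓞 K) p₀, by rw [Ideal.submodule_span_eq]⟩⟩
  -- `e f g = 2`
  have hefg :=
    Ideal.ncard_primesOver_mul_ramificationIdxIn_mul_inertiaDegIn p (𝓞 K) (K ≃ₐ[ℚ] K)
  rw [hG] at hefg
  have hein : ∀ Q ∈ p.primesOver (𝓞 K), Q.ramificationIdx ℤ = p.ramificationIdxIn (𝓞 K) := by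
    intro Q hQ
    haveI := hQ.1
    haveI := hQ.2
    exact (Ideal.ramificationIdxIn_eq_ramificationIdx p Q (K ≃ₐ[ℚ] K)).symm
  -- every prime above `p` is `P` or `τ • P`
  have hconj : ∀ Q ∈ p.primesOver (𝓞 K), Q = P ∨ Q = τ • P := by
    intro Q hQ
    haveI := hQ.1
    haveI := hQ.2
    haveI := hPover.2
    obtain ⟨σ, rfl⟩ := Ideal.exists_smul_eq_of_isGaloisGroup p P Q (K ≃ₐ[ℚ] K)
    rcases eq_one_or_eq_of_card_eq_two hG hτ σ with h | h
    · exact Or.inl (by rw [h, one_smul])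
    · exact Or.inr (by rw [h])
  have hτP : τ • P ∈ p.primesOver (𝓞 K) := by
    have hprime : (τ • P).IsPrime := by
      haveI := v.isPrime
      exact Ideal.IsPrime.smul τ
    refine ⟨hprime, ⟨?_⟩⟩
    rw [Ideal.under_smul]
  have hP0 : P ∈ (Ideal (𝓞 K))⁰ := mem_nonZeroDivisors_iff_ne_zero.mpr v.ne_bot
  have hτP0 : τ • P ∈ (Ideal (𝓞 K))⁰ := smul_asIdeal_mem_nonZeroDivisors τ v
  change ClassGroup.mk0 ⟨P, hP0⟩ * ClassGroup.mk0 ⟨τ • P, hτP0⟩ = 1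
  by_cases hfix : τ • P = P
  · -- `p 𝓞_K = P ^ e` with `e ∣ 2`, so `[P]² = 1`
    have hset : p.primesOver (𝓞 K) = {P} := by
      ext Q
      simp only [Set.mem_singleton_iff]
      constructor
      · intro hQ
        rcases hconj Q hQ with h | h
        · exact h
        · rw [h, hfix]
      · rintro rfl
        exact hPover
    have hncard : (p.primesOver (𝓞 K)).ncard = 1 := by rw [hset, Set.ncard_singleton]
    rw [hncard, one_mul] at hefg
    have hedvd : P.ramificationIdx ℤ ∣ 2 := by
      rw [hein P hPover]
      exact Dvd.intro _ hefg
    have hfac' : p.map (algebraMap ℤ (𝓞 K)) = P ^ P.ramificationIdx ℤ := by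
      rw [hfac]
      simp only [hset, Set.toFinset_singleton, Finset.prod_singleton]
    -- `[P] ^ e = 1`, hence `[P] ^ 2 = 1`
    have hpow : ClassGroup.mk0 ⟨P, hP0⟩ ^ P.ramificationIdx ℤ = 1 := by
      rw [← hprinc, ← map_pow]
      congr 1
      apply Subtype.ext
      rw [SubmonoidClass.mk_pow]
      exact hfac'.symm
    have hsq : ClassGroup.mk0 ⟨P, hP0⟩ ^ 2 = 1 := by
      rcases (Nat.dvd_prime Nat.prime_two).mp hedvd with h1 | h2
      · rw [h1, pow_one] at hpow
        rw [hpow, one_pow]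
      · rwa [h2] at hpow
    have hmk : ClassGroup.mk0 ⟨τ • P, hτP0⟩ = ClassGroup.mk0 ⟨P, hP0⟩ := by
      congr 1
      exact Subtype.ext hfix
    rw [hmk, ← pow_two, hsq]
  · -- `p 𝓞_K = P · τP`, so `[P][τP] = [p 𝓞_K] = 1`
    have hne : P ≠ τ • P := fun h => hfix h.symm
    have hset : p.primesOver (𝓞 K) = {P, τ • P} := by
      symm
      refine Set.eq_of_subset_of_ncard_le ?_ ?_ (IsDedekindDomain.primesOver_finite p (𝓞 K))
      · intro Q hQ
        rcases hQ with rfl | rfl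
        · exact hPover
        · exact hτP
      · -- `g ≤ 2`
        rw [Set.ncard_pair hne]
        have h1 : 1 ≤ p.ramificationIdxIn (𝓞 K) * p.inertiaDegIn (𝓞 K) :=
          Nat.one_le_iff_ne_zero.mpr (mul_ne_zero (Ideal.ramificationIdxIn_ne_zero (K ≃ₐ[ℚ] K))
            (Ideal.inertiaDegIn_ne_zero (K ≃ₐ[ℚ] K)))
        nlinarith [hefg, h1]
    have hncard : (p.primesOver (𝓞 K)).ncard = 2 := by rw [hset, Set.ncard_pair hne]
    rw [hncard] at hefg
    have he1 : p.ramificationIdxIn (𝓞 K) = 1 := by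
      have : p.ramificationIdxIn (𝓞 K) * p.inertiaDegIn (𝓞 K) = 1 := by omega
      exact Nat.eq_one_of_mul_eq_one_right this
    have hfac' : p.map (algebraMap ℤ (𝓞 K)) = P * τ • P := by
      rw [hfac]
      simp only [hset, Set.toFinset_insert, Set.toFinset_singleton]
      rw [Finset.prod_insert (by simpa using hne), Finset.prod_singleton, hein P hPover,
        hein (τ • P) hτP, he1, pow_one, pow_one]
    rw [← map_mul, ← hprinc]
    congr 1
    apply Subtype.ext
    rw [Submonoid.coe_mul]
    exact hfac'.symm

end Literature.NumberTheory.QuadraticFields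

end
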